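import Mathlib
import Summits.NavierStokesRegularity.NavierStokesRegularity.Theorems.TaoLadderRungThreeRestartGlue
import Summits.NavierStokesRegularity.NavierStokesRegularity.Theses.BarrierStepRungThree
import HarnessLib

/-!
# `BarrierStepRungThree.RestartGlue` (item stmt-NavierStokesRegularity-22990)

The support `RestartGlue` of route `BarrierStepRungThree` is, character for character, the shared
support `RestartGlue` of the host routes `TaoLadderRungThree` / `TaoLadderRungTwo` (items
stmt-NavierStokesRegularity-20425 / 20651), already proved in the tree as
`Theorems.RestartGlue.epochCheckpoints_succ` (file `TaoLadderRungThreeRestartGlue.lean`): a `StepTo`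
of the flow restarted at checkpoint `(N, t_N, e_N)` is a level-`N+1` `EpochCheckpoints` of the original
family with `t_{N+1} = t_N + τ₁/γ`, `γ = e_N (1+ε₀)^{5N/2}`, and `e_{N+1} = a · e_N`. This file closes
the item in the `BarrierStepRungThree` reading by that theorem (compare the identical folding
`TrappingWindowRungThreeRestartGlue.lean`).

HONEST FRAMING: definitional bookkeeping about Tao-type MODEL lattice pseudo-flows (Tao 2016 §6);
nothing here is a statement about the Navier–Stokes equations, and the route's rung leaf
(`TaoLadderRungThree.Target`, TL-M3) is not the summit Statement. The route's cruxes
`BarrierCertificate` / `BarrierSoundness` are not touched by this file.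
-/

noncomputable section

-- the sub-problem namespace `Summit.NavierStokesRegularity.NavierStokesRegularity` repeats the summit name by design (D-0017)
set_option linter.dupNamespace false

namespace Summit.NavierStokesRegularity.NavierStokesRegularity.Theorems

open RestartGlue in
/-- **Item stmt-NavierStokesRegularity-22990** (`BarrierStepRungThree.RestartGlue`): a `StepTo` of the
flow restarted at checkpoint `(N, t_N, e_N)` is a level-`N+1` `EpochCheckpoints` of the original family
with `t_{N+1} = t_N + τ₁/γ` and `e_{N+1} = a · e_N`, closed by the tree theorem
`RestartGlue.epochCheckpoints_succ`. [cite: Tao2016AveragedNS, §6.4 with §6.2 Prop. 6.3 (vi)–(ix)] -/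
theorem barrierStepRungThree_restartGlue_proof :
    Summit.NavierStokesRegularity.NavierStokesRegularity.Theses.BarrierStepRungThree.RestartGlue := by
  unfold Summit.NavierStokesRegularity.NavierStokesRegularity.Theses.BarrierStepRungThree.RestartGlue
  intro ε₀ θ c m i₀ n₀ X₀ P Q N X E t e τ₁ a hε₀ hN h hst
  exact epochCheckpoints_succ hε₀ hN h hst

end Summit.NavierStokesRegularity.NavierStokesRegularity.Theorems

end
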